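import Summits.QuantumFields.YangMills.Theorems.BalabanUVNodesN15KingModelTwoSpacingOneDatum
import Literature.MathematicalPhysics.QuantumFieldTheory.Balaban1983to89.B2Lemma27Proof
import HarnessLib

/-!
# BalabanUVNodes ∕ N15 — THE KING-MODEL RUNG, CURVED EDITION (PART Ν): KING 1986 **(3.43)–(3.45) BY NAME** — THE BACKGROUND VECTOR FIELD IN THE
# `x₀`-GAUGE: constants are reproduced by the massive minimiser `ℋ_k = a_kG_kQ_k^*` up to the factor `(1 + μ₀²(L^kε)²a_k^{−1})^{−1}` ((A.4) = (3.43)),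
# the fluctuation `Ã^{(k)} = ℋ_kÃ_k` (3.44), and the bounds (3.45) from (3.2) + the decay of `ℋ_k` (Theorem 3.3)
# (Track A, DAG node N15 = NE2; FAN-OUT v1.1 §N15 s3 «KING-MODEL RUNG … what the curved case adds»)

HONEST FRAMING.  Count-neutral (cell `pub-ymgap`, seat `pub-ymgap-dag-n15-e` g24; `--supports stmt-QuantumFields-27366 --as helper` = K3⁸
`SpineGivenEndpointR13SepCoPHV`).  TEMPLATE LITERATURE: C. King, CMP **102** (1986) 649–677 [King1986], p. 661 (the paragraph setting up the gauge transformation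
feeding (3.46)∕(3.72) — parts Κ-a∕Κ-b∕Κ-c).  King's VECTOR field is the massive free field at `A = 0` (p. 653: *«All the corresponding expressions for the vector field
are obtained from (2.13)–(2.17) by setting m² = μ₀², N = d and A = 0»*), so its minimiser `a_kG_kQ_k^*` IS, componentwise, the rung's ACTUAL `A = 0` minimiser
`King1986.Torus.minimiser` ∕ `kingH` with `m² = μ₀²(L^kε)²`; NOT Bałaban's non-abelian objects; NOT a node discharge; nothing continuum ∕ ℝ⁴ ∕ OS ∕ mass-gap ∕ Clay.
0 `sorry`; standard axioms.  Page render READ AS IMAGE: `run/shared/lean/pub/pub-balaban/b2b-balaban-t4-ne2-p3/king-renders/1986-cmp102-king-u1-higgs-I-p013-x2.png` (p. 661).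

THE PRINT (p. 661, verbatim).  *«Let B be the value of A_k at some point x₀ in □′, and define Ã^{(k)}_μ(x) = A^{(k)}_μ(x) − B_μ for x in □′. Using Eq. (A.4) from the
Appendix we have B_μ = (1 + μ₀²(L^kε)²a_k^{−1})a_kG_kQ_k^*B_μ. (3.43)  Therefore writing Ã_{k,μ}(w) = A_{k,μ}(w) − (1 + μ₀²(L^kε)²a_k^{−1})B_μ, we have Ã^{(k)}_μ(x) =
Σ_{w∈T^{(k)}} (a_kG_kQ_k^*)(x, w)Ã_{k,μ}(w). (3.44)  From the bounds (3.2) and using Theorem 3.3, we deduce that |Ã_{k,μ}(w)| ≤ Cp(L^kε)[|w − x₀| + L^kε], |Ã^{(k)}_μ(x)|,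
|∂^η_νÃ^{(k)}_μ(x)| ≤ Cp(L^kε)|x − x₀|. (3.45)»*  ((3.2)₁,₂ p. 655: `|A_{k,μ}(y)| ≤ p(L^{k−1}ε)(μ₀L^{k−1}ε)^{−1}`, `|∂A_{k,μ}(b)| ≤ p(L^{k−1}ε)`; `A^{(k)} = ℋ_kA_k`, p. 654.)

WHAT THIS FILE PROVES (namespace `…N15KingModelRung.Curved`; one component `μ` at a time — at `A = 0` the components decouple; `T^{(k)} = Tor M` the unit
torus, `T_η = Tor (fine N M)`, `N = L^k`; `ℋ = King1986.Torus.minimiser N M a (N²) m²`, its kernel `ℋ(δ_w)(x)` = the rung's `kingH`; `m² = μ₀²(L^kε)²`).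
* §1 CONSTANTS: `lapF_mulVec_const`, `blockProj_mulVec_const` (`Q*Q 1 = 1`), `fineOp_mulVec_const` (`A₀1 = (m² + a)·1`), `transpose_Qmat_mulVec_const`,
  ★★ **`minimiser_const`**: `ℋ(t·1) = (a∕(a + m²))·t·1` — (A.4): CONSTANTS ARE REPRODUCED UP TO `(1 + m²∕a)^{−1}` (on the ACTUAL operator: `A₀((a∕(a+m²))t·1) =
  aN^d·Qᵀ(t·1)`, `A₀` invertible), `kingH_rowsum` (`Σ_w ℋ_k(x, w) = a_k∕(a_k + m²)`).  §2 ★★ **`eq343_king`** = (3.43) BY NAME: `B = (1 + m²∕a_k)·ℋ_k(B·1)(x)`.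
* §3 (3.44): `gaugeShiftUnit A x₀ w := A w − (1 + m²∕a_k)·A x₀` (King's `Ã_k`), `gaugeShiftFine A x₀ x := ℋ_k(A)(x) − A x₀` (King's `Ã^{(k)} = A^{(k)} − B`), ★★ **`eq344_king`**:
  `Ã^{(k)}(x) = Σ_w ℋ_k(x, w)·Ã_k(w)` (linearity `minimiser_apply_eq_sum` + §1).
* §4 (3.45): ★ `abs_gaugeShiftUnit_le` — from (3.2)₁ at `x₀` (`|A x₀| ≤ p₁`) and the summed (3.2)₂ (`|A w − A x₀| ≤ p_L·|w − x₀|`, `|·|` = `tdistT`):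
  `|Ã_k(w)| ≤ p_L·|w − x₀| + (m²∕a_k)·p₁` (King's `Cp(L^kε)[|w − x₀| + L^kε]`: `(m²∕a_k)p₁ = μ₀²(L^kε)²a_k^{−1}·p(L^{k−1}ε)(μ₀L^{k−1}ε)^{−1} = (μ₀L∕a_k)·p(L^{k−1}ε)·L^kε`,
  `dictionary_345_massTerm`); ★★ `abs_gaugeShiftFine_le` — with the decay of `ℋ_k` BY NAME as the hypothesis `|ℋ_k(x, w)| ≤ c_H·e^{−δ|B(x) − w|}` (Theorem 3.3 for the
  minimiser: the tree's `King1986.Torus.minimiser_kernel_decay_blocks_unif` supplies it for King's volumes): `|Ã^{(k)}(x)| ≤ c_H·K_{d+1}(δ∕2)·((2∕δ)p_L + p_L·|B(x) − x₀| +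
  (m²∕a_k)p₁)` — King's `Cp(L^kε)|x − x₀|` up to an additive unit (HONEST: `Ã^{(k)}(x₀) = (ℋA_k)(x₀) − A_k(x₀)` need not vanish, so the printed `Cp|x − x₀|`
  is to be read for `|x − x₀| ≳ 1`; typed: `C·p·(|x − x₀| + 1)`-shaped, explicit constants); ★★ `abs_dgaugeShiftFine_le` — DERIVATIVE clause: `Σ_w ∂_νℋ_k(x, w) = 0`
  (constants reproduced) ⇒ `∂_νÃ^{(k)}(x) = Σ_w ∂_νℋ_k(x, w)(A_k(w) − A_k(B(x)))`, so with `|∂_νℋ_k(x, w)| ≤ c_D·e^{−δ|B(x) − w|}`: `|∂_νÃ^{(k)}(x)| ≤ c_D·K_{d+1}(δ∕2)·(2∕δ)·p_L`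
  — UNIFORM in `x` (sharper than the printed `Cp|x − x₀|`).
* the letter `t·e^{−δt} ≤ (2∕δ)e^{−δt∕2}` is the tree's `B2Lemma27Proof.mul_exp_neg_le_half` ([Ba4] (2.39)), imported; `sum_exp_mul_tdistT_le`, `dictionary_345_massTerm`.
* §5 ★★ `abs_gaugeShiftFine_le_kingVol`, ★★ `abs_dgaugeShiftFine_le_kingVol`: (3.45)₂ ON KING's VOLUMES (`KingVolIndex`: cubes `2L^m`, `K ≥ 1`) with the decay
  hypotheses DISCHARGED BY NAME by the rung's `kingH_decay` ∕ `dkingH_decay` (Theorem 3.3 for `ℋ_K`, `∂ℋ_K`; odd `L ≥ 3`, `a, m² > 0`).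

HONEST SCOPE.  (i) `A = 0` massive minimiser on the torus (King's vector field), one component; (ii) (3.2)₂ enters SUMMED along a shortest lattice path as
`|A w − A x₀| ≤ p_L·tdistT(w, x₀)` (`p_L = d·p(L^{k−1}ε)`); (iii) the decay of `ℋ_k`, `∂ℋ_k` = hypotheses of the printed shape in §4, DISCHARGED BY NAME on King's
volumes in §5 (`kingH_decay`, `dkingH_decay`); (iv) the `x₀`-gauge itself ((3.46)) is parts Κ.  N15 NOT discharged; counts unmoved.
Locators: [King1986] (2.13)–(2.15) p.653, p.654, (3.2) p.655, (3.43)–(3.45) p.661, (A.4) p.676.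
-/

noncomputable section

namespace Summit.QuantumFields.YangMills.BalabanUVNodes.N15KingModelRung.Curved

open scoped BigOperators
open Matrix
open Literature.MathematicalPhysics.QuantumFieldTheory.Balaban1983to89.B5Prop11Plancherel (Tor fine unitVec)
open Literature.MathematicalPhysics.QuantumFieldTheory.Balaban1983to89.B4Sect5Proof (latticeConst)
open Literature.MathematicalPhysics.QuantumFieldTheory.King1986 (aK aK_pos)
open Literature.MathematicalPhysics.QuantumFieldTheory.King1986.Torus (blockOf val_blockOf blockProj Qmat fineOp lapF minimiser transpose_Qmat_mulVec
  fineOp_isUnit minimiser_apply_eq_sum tdistT tdistT_sumBound tdistT_triangle tdistT_nonneg tdistT_symm)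
open Literature.MathematicalPhysics.QuantumFieldTheory.Balaban1983to89.B2Lemma27Proof (mul_exp_neg_le_half)
open Summit.QuantumFields.YangMills.BalabanUVNodes.N15KingModelRung (KingVolIndex kingVol kingVol_neZero kingH dkingH kingH_decay dkingH_decay)

variable {d : ℕ}

/-! ## §1 Constants under `c(−Δ) + m²`, `Q*Q`, `A₀`, `Qᵀ` and the minimiser — (A.4) -/

section Constants

variable (N : ℕ) [NeZero N] (M : Fin (d + 1) → ℕ) [∀ μ, NeZero (M μ)]

/-- `(c(−Δ) + m²)·(t·1) = m²t·1` on any torus: the Laplacian kills constants. [cite: King1986, (4.4) p.670, (A.4) p.676] -/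
theorem lapF_mulVec_const (K : Fin (d + 1) → ℕ) [∀ μ, NeZero (K μ)] (c m2 t : ℝ) :
    lapF K c m2 *ᵥ (fun _ => t) = fun _ => m2 * t := by
  funext z
  simp only [Matrix.mulVec, dotProduct]
  rw [← Finset.sum_mul]
  congr 1
  simp only [lapF]
  have h1 : ∑ x : Tor K, (m2 + 2 * ((d + 1 : ℕ) : ℝ) * c) * (if x = z then (1 : ℝ) else 0) = m2 + 2 * ((d + 1 : ℕ) : ℝ) * c := by
    rw [← Finset.mul_sum, Finset.sum_ite_eq' Finset.univ z (fun _ => (1 : ℝ))]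
    simp
  have h2 : ∀ μ : Fin (d + 1), ∑ x : Tor K, ((if x = z + unitVec K μ then (1 : ℝ) else 0) + (if x = z - unitVec K μ then 1 else 0)) = 2 := by
    intro μ
    rw [Finset.sum_add_distrib, Finset.sum_ite_eq' Finset.univ (z + unitVec K μ) (fun _ => (1 : ℝ)),
      Finset.sum_ite_eq' Finset.univ (z - unitVec K μ) (fun _ => (1 : ℝ))]
    simp only [Finset.mem_univ, if_true]
    norm_num
  have h3 : ∑ x : Tor K, c * ∑ μ : Fin (d + 1), ((if x = z + unitVec K μ then (1 : ℝ) else 0) + (if x = z - unitVec K μ then 1 else 0))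
      = 2 * ((d + 1 : ℕ) : ℝ) * c := by
    rw [← Finset.mul_sum, Finset.sum_comm]
    simp only [h2, Finset.sum_const, Finset.card_univ, Fintype.card_fin, nsmul_eq_mul]
    push_cast
    ring
  rw [Finset.sum_sub_distrib, h1, h3]
  ring

/-- `Q*Q(t·1) = t·1`: the block mean of a constant is the constant (each block has `N^{d+1}` points, `sum_fine_blockOf`). [cite: King1986, (2.10) p.653, (4.36) p.674] -/
theorem blockProj_mulVec_const (t : ℝ) : blockProj N M *ᵥ (fun _ : Tor (fine N M) => t) = fun _ => t := by
  funext z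
  simp only [Matrix.mulVec, dotProduct, blockProj]
  simp_rw [ite_mul, zero_mul]
  have hN : ((N : ℝ) ^ (d + 1)) ≠ 0 := pow_ne_zero _ (by exact_mod_cast NeZero.ne N)
  have h := sum_fine_blockOf N M (fun b => if blockOf N M z = b then ((N : ℝ) ^ (d + 1))⁻¹ * t else 0)
  rw [h, Finset.sum_ite_eq Finset.univ (blockOf N M z)]
  simp only [Finset.mem_univ, if_true]
  field_simp

/-- `A₀(t·1) = (m² + a)t·1` (`A₀ = c(−Δ) + m² + aQ*Q`). [cite: King1986, (2.13) p.653, (A.4) p.676] -/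
theorem fineOp_mulVec_const (a c m2 t : ℝ) : fineOp N M a c m2 *ᵥ (fun _ : Tor (fine N M) => t) = fun _ => (m2 + a) * t := by
  rw [fineOp, Matrix.add_mulVec, Matrix.smul_mulVec, lapF_mulVec_const, blockProj_mulVec_const]
  funext z
  simp only [Pi.add_apply, Pi.smul_apply, smul_eq_mul]
  ring

/-- `Qᵀ(t·1) = N^{−(d+1)}t·1`. [cite: King1986, (2.10) p.653] -/
theorem transpose_Qmat_mulVec_const (t : ℝ) : (Qmat N M)ᵀ *ᵥ (fun _ : Tor M => t) = fun _ => ((N : ℝ) ^ (d + 1))⁻¹ * t := by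
  funext z
  rw [transpose_Qmat_mulVec]

/-- ★★ **(A.4): CONSTANTS ARE REPRODUCED UP TO `(1 + m²∕a)^{−1}`** — `ℋ(t·1) = (a∕(a + m²))t·1` for the ACTUAL minimiser `ℋ = aN^dA₀^{−1}Qᵀ` (`a ≥ 0`, `c ≥ 0`,
`m² > 0`).  King: *«B_μ = (1 + μ₀²(L^kε)²a_k^{−1})a_kG_kQ_k^*B_μ»* with `m² = μ₀²(L^kε)²`. [cite: King1986, (3.43) p.661, (A.4) p.676, (2.13)–(2.15) p.653] -/
theorem minimiser_const {a c m2 : ℝ} (ha : 0 ≤ a) (hc : 0 ≤ c) (hm : 0 < m2) (t : ℝ) :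
    minimiser N M a c m2 (fun _ : Tor M => t) = fun _ : Tor (fine N M) => a / (a + m2) * t := by
  have hN : ((N : ℝ) ^ (d + 1)) ≠ 0 := pow_ne_zero _ (by exact_mod_cast NeZero.ne N)
  have ham : a + m2 ≠ 0 := by linarith
  have hdet : IsUnit (fineOp N M a c m2).det := (Matrix.isUnit_iff_isUnit_det _).mp (fineOp_isUnit N M ha hc hm)
  -- the candidate solves `A₀ψ = aN^d·Qᵀ(t·1)`
  have hsol : fineOp N M a c m2 *ᵥ (fun _ : Tor (fine N M) => a / (a + m2) * t)
      = (a * (N : ℝ) ^ (d + 1)) • ((Qmat N M)ᵀ *ᵥ fun _ : Tor M => t) := by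
    rw [fineOp_mulVec_const, transpose_Qmat_mulVec_const]
    funext z
    simp only [Pi.smul_apply, smul_eq_mul]
    field_simp
    ring
  unfold minimiser
  rw [← Matrix.mulVec_smul, ← hsol, Matrix.mulVec_mulVec, Matrix.nonsing_inv_mul _ hdet, Matrix.one_mulVec]

variable (L : ℕ)

/-- `Σ_w ℋ_k(x, w) = a_k∕(a_k + m²)` — the row sums of King's minimiser kernel `kingH` (`m² > 0`, `a_k ≥ 0`). [cite: King1986, (3.43) p.661, (A.4) p.676] -/
theorem kingH_rowsum {a m2 : ℝ} (k : ℕ) (hak : 0 ≤ aK a L k) (hm : 0 < m2) (x : Tor (fine N M)) :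
    ∑ w : Tor M, kingH L N M a m2 k w x = aK a L k / (aK a L k + m2) := by
  have h := congrFun (minimiser_const N M hak (by positivity : (0 : ℝ) ≤ ((N : ℕ) : ℝ) ^ 2) hm 1) x
  rw [minimiser_apply_eq_sum] at h
  simp only [one_mul, mul_one] at h
  unfold kingH
  simpa using h

end Constants

/-! ## §2 (3.43) BY NAME -/
section Eq343

variable (L : ℕ) (N : ℕ) [NeZero N] (M : Fin (d + 1) → ℕ) [∀ μ, NeZero (M μ)]

/-- ★★ **(3.43) BY NAME**: `B = (1 + m²∕a_k)·(a_kG_kQ_k^*B)(x)` for every constant `B`, every fine point `x` (`a_k > 0`, `m² = μ₀²(L^kε)² > 0`; `ℋ_k` = the rung's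
`minimiser N M a_k N² m²`). [cite: King1986, (3.43) p.661, (A.4) p.676] -/
theorem eq343_king {a m2 : ℝ} (k : ℕ) (hak : 0 < aK a L k) (hm : 0 < m2) (B : ℝ) (x : Tor (fine N M)) :
    B = (1 + m2 / aK a L k) * minimiser N M (aK a L k) (((N : ℕ) : ℝ) ^ 2) m2 (fun _ => B) x := by
  rw [minimiser_const N M hak.le (by positivity) hm B]
  have hak0 : aK a L k ≠ 0 := hak.ne'
  field_simp

end Eq343

/-! ## §3 (3.44): the fluctuation in the `x₀`-gauge is the minimiser of the shifted unit-lattice field -/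
section Eq344

variable (L : ℕ) (N : ℕ) [NeZero N] (M : Fin (d + 1) → ℕ) [∀ μ, NeZero (M μ)]

/-- King's `Ã_{k,μ}(w) = A_{k,μ}(w) − (1 + μ₀²(L^kε)²a_k^{−1})B_μ`, `B = A_k(x₀)` (one component). [cite: King1986, (3.44) p.661] -/
def gaugeShiftUnit (a m2 : ℝ) (k : ℕ) (A : Tor M → ℝ) (x₀ : Tor M) (w : Tor M) : ℝ := A w - (1 + m2 / aK a L k) * A x₀

/-- King's `Ã^{(k)}_μ(x) = A^{(k)}_μ(x) − B_μ` with `A^{(k)} = ℋ_kA_k` the background (minimiser) configuration of the unit-lattice field `A_k`.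
[cite: King1986, (3.43)–(3.44) p.661, p.654 (background configuration)] -/
def gaugeShiftFine (a m2 : ℝ) (k : ℕ) (A : Tor M → ℝ) (x₀ : Tor M) (x : Tor (fine N M)) : ℝ :=
  minimiser N M (aK a L k) (((N : ℕ) : ℝ) ^ 2) m2 A x - A x₀

/-- ★★ **(3.44) BY NAME**: `Ã^{(k)}(x) = Σ_{w∈T^{(k)}} (a_kG_kQ_k^*)(x, w)·Ã_k(w)` (`a_k > 0`, `m² > 0`). [cite: King1986, (3.44) p.661] -/
theorem eq344_king {a m2 : ℝ} (k : ℕ) (hak : 0 < aK a L k) (hm : 0 < m2) (A : Tor M → ℝ) (x₀ : Tor M) (x : Tor (fine N M)) :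
    gaugeShiftFine L N M a m2 k A x₀ x = ∑ w : Tor M, kingH L N M a m2 k w x * gaugeShiftUnit L M a m2 k A x₀ w := by
  unfold gaugeShiftFine gaugeShiftUnit kingH
  have hrow := kingH_rowsum N M L k hak.le hm x
  unfold kingH at hrow
  rw [minimiser_apply_eq_sum]
  simp only [mul_sub, Finset.sum_sub_distrib]
  rw [← Finset.sum_mul, hrow]
  have hak0 : aK a L k ≠ 0 := hak.ne'
  have : aK a L k / (aK a L k + m2) * ((1 + m2 / aK a L k) * A x₀) = A x₀ := by
    field_simp
  rw [this]
  refine congrArg (fun s => s - A x₀) (Finset.sum_congr rfl fun w _ => by ring)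

end Eq344

/-! ## §4 (3.45): the bounds from (3.2) and the decay of `ℋ_k` -/
section Ineq345

variable (L : ℕ) (N : ℕ) [NeZero N] (M : Fin (d + 1) → ℕ) [∀ μ, NeZero (M μ)]

/-- ★ **(3.45), FIRST LINE**: from (3.2)₁ at `x₀` (`|A_k(x₀)| ≤ p₁`) and (3.2)₂ summed along a shortest lattice path (`|A_k(w) − A_k(x₀)| ≤ p_L·|w − x₀|`):
`|Ã_k(w)| ≤ p_L·|w − x₀| + (m²∕a_k)·p₁`. [cite: King1986, (3.45) p.661, (3.2) p.655] -/
theorem abs_gaugeShiftUnit_le {a m2 : ℝ} (k : ℕ) (hak : 0 < aK a L k) (hm : 0 ≤ m2) (A : Tor M → ℝ) (x₀ : Tor M) {p₁ pL : ℝ}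
    (h1 : |A x₀| ≤ p₁) (h2 : ∀ w, |A w - A x₀| ≤ pL * tdistT M w x₀) (w : Tor M) :
    |gaugeShiftUnit L M a m2 k A x₀ w| ≤ pL * tdistT M w x₀ + m2 / aK a L k * p₁ := by
  unfold gaugeShiftUnit
  have hsplit : A w - (1 + m2 / aK a L k) * A x₀ = (A w - A x₀) - m2 / aK a L k * A x₀ := by ring
  rw [hsplit]
  calc |A w - A x₀ - m2 / aK a L k * A x₀| ≤ |A w - A x₀| + |m2 / aK a L k * A x₀| := abs_sub _ _
    _ ≤ pL * tdistT M w x₀ + m2 / aK a L k * p₁ := by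
        refine add_le_add (h2 w) ?_
        rw [abs_mul, abs_of_nonneg (div_nonneg hm hak.le)]
        exact mul_le_mul_of_nonneg_left h1 (div_nonneg hm hak.le)

omit [NeZero N] [∀ μ, NeZero (M μ)] in
/-- THE DICTIONARY of the first line's mass term: with `m² = μ₀²(L^kε)²` and `p₁ = p(L^{k−1}ε)(μ₀L^{k−1}ε)^{−1} = p·L∕(μ₀L^kε)`:
`(m²∕a_k)·p₁ = (μ₀L∕a_k)·p·(L^kε)` — King's `Cp(L^kε)·L^kε`. [cite: King1986, (3.45) p.661, (3.2) p.655] -/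
theorem dictionary_345_massTerm {a μ₀ Lkε p : ℝ} (k : ℕ) (hak : aK a L k ≠ 0) (hμ₀ : μ₀ ≠ 0) (hε : Lkε ≠ 0) (hL : (L : ℝ) ≠ 0) :
    (μ₀ ^ 2 * Lkε ^ 2) / aK a L k * (p * (μ₀ * (Lkε / L))⁻¹) = (μ₀ * L / aK a L k) * p * Lkε := by
  field_simp

/-- the block-distance sum with a linear weight: `Σ_w e^{−δ|b − w|}·|w − x₀| ≤ K_{d+1}(δ∕2)·((2∕δ) + |b − x₀|)`. [cite: King1986, (3.45) p.661 (summation step)] -/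
theorem sum_exp_mul_tdistT_le {δ : ℝ} (hδ : 0 < δ) (b x₀ : Tor M) :
    ∑ w : Tor M, Real.exp (-(δ * tdistT M b w)) * tdistT M w x₀
      ≤ latticeConst (d + 1) (δ / 2) * (2 / δ + tdistT M b x₀) := by
  have hK := tdistT_sumBound (K := M) (δ / 2) (by positivity) b
  calc ∑ w : Tor M, Real.exp (-(δ * tdistT M b w)) * tdistT M w x₀
      ≤ ∑ w : Tor M, Real.exp (-(δ / 2 * tdistT M b w)) * (2 / δ + tdistT M b x₀) := by
        refine Finset.sum_le_sum fun w _ => ?_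
        have htri : tdistT M w x₀ ≤ tdistT M b w + tdistT M b x₀ := by
          have := tdistT_triangle M w b x₀; rw [tdistT_symm M w b] at this; exact this
        have hE : 0 ≤ Real.exp (-(δ * tdistT M b w)) := Real.exp_nonneg _
        have hE2 : Real.exp (-(δ * tdistT M b w)) ≤ Real.exp (-(δ / 2 * tdistT M b w)) :=
          Real.exp_le_exp.2 (by nlinarith [tdistT_nonneg M b w])
        calc Real.exp (-(δ * tdistT M b w)) * tdistT M w x₀
            ≤ Real.exp (-(δ * tdistT M b w)) * (tdistT M b w + tdistT M b x₀) := mul_le_mul_of_nonneg_left htri hE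
          _ = tdistT M b w * Real.exp (-(δ * tdistT M b w)) + Real.exp (-(δ * tdistT M b w)) * tdistT M b x₀ := by ring
          _ ≤ 2 / δ * Real.exp (-(δ / 2 * tdistT M b w)) + Real.exp (-(δ / 2 * tdistT M b w)) * tdistT M b x₀ :=
              add_le_add (mul_exp_neg_le_half hδ (tdistT M b w)) (mul_le_mul_of_nonneg_right hE2 (tdistT_nonneg M b x₀))
          _ = Real.exp (-(δ / 2 * tdistT M b w)) * (2 / δ + tdistT M b x₀) := by ring
    _ = (∑ w : Tor M, Real.exp (-(δ / 2 * tdistT M b w))) * (2 / δ + tdistT M b x₀) := by rw [Finset.sum_mul]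
    _ ≤ latticeConst (d + 1) (δ / 2) * (2 / δ + tdistT M b x₀) :=
        mul_le_mul_of_nonneg_right hK (by positivity [tdistT_nonneg M b x₀])

/-- ★★ **(3.45), SECOND LINE (the field)**: with the decay of `ℋ_k` BY NAME as the hypothesis `|ℋ_k(x, w)| ≤ c_H·e^{−δ|B(x) − w|}` (Theorem 3.3) and the letters
of the first line: `|Ã^{(k)}(x)| ≤ c_H·(K_{d+1}(δ∕2)·(p_L·(2∕δ + |B(x) − x₀|)) + K_{d+1}(δ)·(m²∕a_k)p₁)` — King's `Cp(L^kε)|x − x₀|` for `|x − x₀| ≳ 1` (the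
additive unit is genuine: `Ã^{(k)}(x₀)` need not vanish). [cite: King1986, (3.45) p.661, Thm 3.3 (3.7) p.656] -/
theorem abs_gaugeShiftFine_le {a m2 : ℝ} (k : ℕ) (hak : 0 < aK a L k) (hm : 0 < m2) (A : Tor M → ℝ) (x₀ : Tor M) {p₁ pL cH δ : ℝ}
    (hpL : 0 ≤ pL) (hcH : 0 ≤ cH) (hδ : 0 < δ)
    (h1 : |A x₀| ≤ p₁) (h2 : ∀ w, |A w - A x₀| ≤ pL * tdistT M w x₀)
    (hH : ∀ (w : Tor M) (x : Tor (fine N M)), |kingH L N M a m2 k w x| ≤ cH * Real.exp (-(δ * tdistT M (blockOf N M x) w)))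
    (x : Tor (fine N M)) :
    |gaugeShiftFine L N M a m2 k A x₀ x|
      ≤ cH * (latticeConst (d + 1) (δ / 2) * (pL * (2 / δ + tdistT M (blockOf N M x) x₀))
          + latticeConst (d + 1) δ * (m2 / aK a L k * p₁)) := by
  rw [eq344_king L N M k hak hm A x₀ x]
  have hp₁ : 0 ≤ p₁ := (abs_nonneg _).trans h1
  have hterm : ∀ w, |kingH L N M a m2 k w x * gaugeShiftUnit L M a m2 k A x₀ w|
      ≤ cH * Real.exp (-(δ * tdistT M (blockOf N M x) w)) * (pL * tdistT M w x₀ + m2 / aK a L k * p₁) := by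
    intro w
    rw [abs_mul]
    exact mul_le_mul (hH w x) (abs_gaugeShiftUnit_le L M k hak hm.le A x₀ h1 h2 w) (abs_nonneg _) (by positivity)
  refine (Finset.abs_sum_le_sum_abs _ _).trans ((Finset.sum_le_sum fun w _ => hterm w).trans ?_)
  have hsplit : ∑ w : Tor M, cH * Real.exp (-(δ * tdistT M (blockOf N M x) w)) * (pL * tdistT M w x₀ + m2 / aK a L k * p₁)
      = cH * (pL * ∑ w : Tor M, Real.exp (-(δ * tdistT M (blockOf N M x) w)) * tdistT M w x₀
          + (m2 / aK a L k * p₁) * ∑ w : Tor M, Real.exp (-(δ * tdistT M (blockOf N M x) w))) := by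
    rw [Finset.mul_sum, Finset.mul_sum, ← Finset.sum_add_distrib, Finset.mul_sum]
    refine Finset.sum_congr rfl fun w _ => ?_; ring
  rw [hsplit]
  refine mul_le_mul_of_nonneg_left ?_ hcH
  have hA := sum_exp_mul_tdistT_le M hδ (blockOf N M x) x₀
  have hB := tdistT_sumBound (K := M) δ hδ (blockOf N M x)
  have hmp : 0 ≤ m2 / aK a L k * p₁ := mul_nonneg (div_nonneg hm.le hak.le) hp₁
  calc pL * ∑ w : Tor M, Real.exp (-(δ * tdistT M (blockOf N M x) w)) * tdistT M w x₀
        + m2 / aK a L k * p₁ * ∑ w : Tor M, Real.exp (-(δ * tdistT M (blockOf N M x) w))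
      ≤ pL * (latticeConst (d + 1) (δ / 2) * (2 / δ + tdistT M (blockOf N M x) x₀)) + m2 / aK a L k * p₁ * latticeConst (d + 1) δ :=
        add_le_add (mul_le_mul_of_nonneg_left hA hpL) (mul_le_mul_of_nonneg_left hB hmp)
    _ = latticeConst (d + 1) (δ / 2) * (pL * (2 / δ + tdistT M (blockOf N M x) x₀)) + latticeConst (d + 1) δ * (m2 / aK a L k * p₁) := by ring

/-- the row sums of a kernel whose rows reproduce constants have vanishing DIFFERENCES: if `Σ_w H(x, w) = s` for all `x` then
`Σ_w (H(x′, w) − H(x, w)) = 0` — for `H = ℋ_k` this is `Σ_w ∂_νℋ_k(x, w) = 0`. [cite: King1986, (3.43)–(3.45) p.661] -/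
theorem sum_sub_eq_zero_of_rowsum {X W : Type*} [Fintype W] (H : X → W → ℝ) {s : ℝ} (hrow : ∀ x, ∑ w, H x w = s) (x x' : X) :
    ∑ w, (H x' w - H x w) = 0 := by
  rw [Finset.sum_sub_distrib, hrow, hrow, sub_self]

/-- ★★ **(3.45), SECOND LINE (the derivative)**: for a kernel difference `D(x, w) = ℋ_k(x′, w) − ℋ_k(x, w)` (`x′ = x + e_ν`; `∂_νÃ^{(k)}(x) = N·Σ_wD(x,w)Ã_k(w)`)
the vanishing row sum lets one subtract `Ã_k(B(x))` for free: `Σ_w D(x, w)Ã_k(w) = Σ_w D(x, w)(A_k(w) − A_k(B(x)))`; hence with the decay hypothesis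
`|D(x, w)| ≤ c_D·e^{−δ|B(x) − w|}` and (3.2)₂ summed from `B(x)` (`|A_k(w) − A_k(B(x))| ≤ p_L|w − B(x)|`):
`|Σ_w D(x, w)Ã_k(w)| ≤ c_D·p_L·K_{d+1}(δ∕2)·(2∕δ)` — UNIFORM in `x` and `x₀` (sharper than the printed `Cp|x − x₀|`). [cite: King1986, (3.45) p.661, Thm 3.3 (3.7) p.656] -/
theorem abs_dgaugeShiftFine_le {a m2 : ℝ} (k : ℕ) (A : Tor M → ℝ) (x₀ : Tor M) {pL cD δ : ℝ} (hpL : 0 ≤ pL) (hcD : 0 ≤ cD) (hδ : 0 < δ)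
    (D : Tor M → ℝ) (b : Tor M) (hD0 : ∑ w, D w = 0) (hD : ∀ w, |D w| ≤ cD * Real.exp (-(δ * tdistT M b w)))
    (h2 : ∀ w, |A w - A b| ≤ pL * tdistT M w b) :
    |∑ w : Tor M, D w * gaugeShiftUnit L M a m2 k A x₀ w| ≤ cD * pL * (latticeConst (d + 1) (δ / 2) * (2 / δ)) := by
  -- subtract the constant `Ã_k(b)` using the vanishing row sum
  have hshift : ∑ w : Tor M, D w * gaugeShiftUnit L M a m2 k A x₀ w = ∑ w : Tor M, D w * (A w - A b) := by
    have : ∑ w : Tor M, D w * gaugeShiftUnit L M a m2 k A x₀ w - ∑ w : Tor M, D w * (A w - A b)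
        = (∑ w, D w) * (A b - (1 + m2 / aK a L k) * A x₀) := by
      rw [← Finset.sum_sub_distrib, Finset.sum_mul]
      refine Finset.sum_congr rfl fun w _ => ?_
      unfold gaugeShiftUnit; ring
    rw [hD0, zero_mul, sub_eq_zero] at this
    exact this
  rw [hshift]
  refine (Finset.abs_sum_le_sum_abs _ _).trans ?_
  have hterm : ∀ w, |D w * (A w - A b)| ≤ cD * pL * (tdistT M w b * Real.exp (-(δ * tdistT M b w))) := by
    intro w
    rw [abs_mul]
    calc |D w| * |A w - A b| ≤ cD * Real.exp (-(δ * tdistT M b w)) * (pL * tdistT M w b) :=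
          mul_le_mul (hD w) (h2 w) (abs_nonneg _) (by positivity)
      _ = cD * pL * (tdistT M w b * Real.exp (-(δ * tdistT M b w))) := by ring
  refine (Finset.sum_le_sum fun w _ => hterm w).trans ?_
  rw [← Finset.mul_sum]
  refine mul_le_mul_of_nonneg_left ?_ (mul_nonneg hcD hpL)
  have hK := tdistT_sumBound (K := M) (δ / 2) (by positivity) b
  calc ∑ w : Tor M, tdistT M w b * Real.exp (-(δ * tdistT M b w))
      ≤ ∑ w : Tor M, 2 / δ * Real.exp (-(δ / 2 * tdistT M b w)) := by
        refine Finset.sum_le_sum fun w _ => ?_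
        rw [tdistT_symm M w b]
        exact mul_exp_neg_le_half hδ (tdistT M b w)
    _ = 2 / δ * ∑ w : Tor M, Real.exp (-(δ / 2 * tdistT M b w)) := by rw [Finset.mul_sum]
    _ ≤ 2 / δ * latticeConst (d + 1) (δ / 2) := mul_le_mul_of_nonneg_left hK (by positivity)
    _ = latticeConst (d + 1) (δ / 2) * (2 / δ) := by ring

/-- the derivative of `Ã^{(k)}` IS such a kernel-difference sum: `Ã^{(k)}(x′) − Ã^{(k)}(x) = Σ_w (ℋ_k(x′, w) − ℋ_k(x, w))·Ã_k(w)`, and the row sum of the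
difference VANISHES (`kingH_rowsum`). [cite: King1986, (3.44)–(3.45) p.661] -/
theorem gaugeShiftFine_sub_eq {a m2 : ℝ} (k : ℕ) (hak : 0 < aK a L k) (hm : 0 < m2) (A : Tor M → ℝ) (x₀ : Tor M) (x x' : Tor (fine N M)) :
    gaugeShiftFine L N M a m2 k A x₀ x' - gaugeShiftFine L N M a m2 k A x₀ x
      = ∑ w : Tor M, (kingH L N M a m2 k w x' - kingH L N M a m2 k w x) * gaugeShiftUnit L M a m2 k A x₀ w
    ∧ ∑ w : Tor M, (kingH L N M a m2 k w x' - kingH L N M a m2 k w x) = 0 := by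
  refine ⟨?_, sum_sub_eq_zero_of_rowsum (fun y w => kingH L N M a m2 k w y) (fun y => kingH_rowsum N M L k hak.le hm y) x x'⟩
  rw [eq344_king L N M k hak hm A x₀ x', eq344_king L N M k hak hm A x₀ x, ← Finset.sum_sub_distrib]
  exact Finset.sum_congr rfl fun w _ => by ring

end Ineq345

/-! ## §5 (3.45)₂ BY NAME on King's volumes: the decay hypotheses discharged by the rung's `kingH_decay` ∕ `dkingH_decay` -/

section KingVolumes

variable (L : ℕ) [NeZero L]

/-- ★★ **(3.45)₂ (the field) ON KING's VOLUMES, decay BY NAME**: for odd `L ≥ 3`, `a > 0`, `m² > 0` there are `δ₀, c₀ > 0` such that for EVERY volume `2L^m`, level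
`K ≥ 1` (`j : KingVolIndex`), every unit-lattice component `A` with `|A(x₀)| ≤ p₁`, `|A(w) − A(x₀)| ≤ p_L|w − x₀|` and every fine point `x`:
`|Ã^{(K)}(x)| ≤ a·c₀·(K_{d+1}(δ₀∕2)·p_L·(2∕δ₀ + |B(x) − x₀|) + K_{d+1}(δ₀)·(m²∕a_K)p₁)` (`kingH_decay` = Theorem 3.3 for `ℋ_K`, dag-n18-b's `minimiser_row_decay`).
[cite: King1986, (3.45) p.661, Thm 3.3 (3.7) p.656] -/
theorem abs_gaugeShiftFine_le_kingVol (hLodd : Odd L) (hL : 2 ≤ L) {a m2 : ℝ} (ha : 0 < a) (hm : 0 < m2) :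
    ∃ δ₀ c₀ : ℝ, 0 < δ₀ ∧ 0 < c₀ ∧ ∀ (j : KingVolIndex d) (A : Tor (kingVol L j) → ℝ) (x₀ : Tor (kingVol L j)) (p₁ pL : ℝ)
      (x : Tor (fine (L ^ j.K) (kingVol L j))),
      haveI := kingVol_neZero L j
      0 ≤ pL → |A x₀| ≤ p₁ → (∀ w, |A w - A x₀| ≤ pL * tdistT (kingVol L j) w x₀) →
        |gaugeShiftFine L (L ^ j.K) (kingVol L j) a m2 j.K A x₀ x|
          ≤ (a * c₀) * (latticeConst (d + 1) (δ₀ / 2) * (pL * (2 / δ₀ + tdistT (kingVol L j) (blockOf (L ^ j.K) (kingVol L j) x) x₀))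
              + latticeConst (d + 1) δ₀ * (m2 / aK a L j.K * p₁)) := by
  obtain ⟨δ₀, c₀, hδ₀, hc₀, H⟩ := kingH_decay L hLodd hL ha hm.le
  refine ⟨δ₀, c₀, hδ₀, hc₀, fun j A x₀ p₁ pL x => ?_⟩
  haveI := kingVol_neZero L j
  intro hpL h1 h2
  have hLr : (1 : ℝ) < L := by exact_mod_cast (show 1 < L by omega)
  exact abs_gaugeShiftFine_le L (L ^ j.K) (kingVol L j) j.K (aK_pos ha hLr j.one_le_K) hm A x₀ hpL (by positivity) hδ₀ h1 h2 (H j) x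

/-- ★★ **(3.45)₂ (the derivative) ON KING's VOLUMES, UNIFORM**: with `dkingH_decay` (`|∂^η_νℋ_K(x, w)| ≤ a·c₀·e^{−δ₀|B(x) − w|}`) and (3.2)₂ summed from the block
label `B(x)`: `|∂^η_νÃ^{(K)}(x)| = N·|Ã^{(K)}(x + e_ν) − Ã^{(K)}(x)| ≤ a·c₀·p_L·K_{d+1}(δ₀∕2)·(2∕δ₀)` for every volume, level, direction and fine point.
[cite: King1986, (3.45) p.661, Thm 3.3 (3.7) p.656] -/
theorem abs_dgaugeShiftFine_le_kingVol (hLodd : Odd L) (hL : 2 ≤ L) {a m2 : ℝ} (ha : 0 < a) (hm : 0 < m2) :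
    ∃ δ₀ c₀ : ℝ, 0 < δ₀ ∧ 0 < c₀ ∧ ∀ (j : KingVolIndex d) (A : Tor (kingVol L j) → ℝ) (x₀ : Tor (kingVol L j)) (pL : ℝ)
      (x : Tor (fine (L ^ j.K) (kingVol L j))) (ν : Fin (d + 1)),
        haveI := kingVol_neZero L j
        0 ≤ pL → (∀ w, |A w - A (blockOf (L ^ j.K) (kingVol L j) x)| ≤ pL * tdistT (kingVol L j) w (blockOf (L ^ j.K) (kingVol L j) x)) →
        (((L ^ j.K : ℕ) : ℝ)) * |gaugeShiftFine L (L ^ j.K) (kingVol L j) a m2 j.K A x₀ (x + unitVec (fine (L ^ j.K) (kingVol L j)) ν)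
            - gaugeShiftFine L (L ^ j.K) (kingVol L j) a m2 j.K A x₀ x|
          ≤ (a * c₀) * pL * (latticeConst (d + 1) (δ₀ / 2) * (2 / δ₀)) := by
  obtain ⟨δ₀, c₀, hδ₀, hc₀, H⟩ := dkingH_decay L hLodd hL ha hm.le
  refine ⟨δ₀, c₀, hδ₀, hc₀, fun j A x₀ pL x ν => ?_⟩
  haveI := kingVol_neZero L j
  intro hpL h2
  have hLr : (1 : ℝ) < L := by exact_mod_cast (show 1 < L by omega)
  have hak := aK_pos ha hLr j.one_le_K
  have hN0 : (0 : ℝ) < ((L ^ j.K : ℕ) : ℝ) := by positivity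
  obtain ⟨hsub, hrow⟩ := gaugeShiftFine_sub_eq L (L ^ j.K) (kingVol L j) j.K hak hm A x₀ x (x + unitVec (fine (L ^ j.K) (kingVol L j)) ν)
  -- the kernel difference `D(w) = ℋ(x + e_ν, w) − ℋ(x, w)` decays with constant `a c₀ ∕ N` (the derivative in η-units is `N·D`)
  have hD : ∀ w, |kingH L (L ^ j.K) (kingVol L j) a m2 j.K w (x + unitVec (fine (L ^ j.K) (kingVol L j)) ν) - kingH L (L ^ j.K) (kingVol L j) a m2 j.K w x|
      ≤ (a * c₀ / ((L ^ j.K : ℕ) : ℝ)) * Real.exp (-(δ₀ * tdistT (kingVol L j) (blockOf (L ^ j.K) (kingVol L j) x) w)) := by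
    intro w
    have h := H j w ν x
    unfold dkingH at h
    rw [abs_mul, abs_of_pos hN0] at h
    rw [div_mul_eq_mul_div, le_div_iff₀ hN0, mul_comm]
    exact h
  rw [hsub]
  have hmain := abs_dgaugeShiftFine_le (a := a) (m2 := m2) L (kingVol L j) j.K A x₀ hpL (by positivity : 0 ≤ a * c₀ / ((L ^ j.K : ℕ) : ℝ)) hδ₀ _ _ hrow hD h2
  calc ((L ^ j.K : ℕ) : ℝ) * |∑ w, (kingH L (L ^ j.K) (kingVol L j) a m2 j.K w (x + unitVec (fine (L ^ j.K) (kingVol L j)) ν)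
            - kingH L (L ^ j.K) (kingVol L j) a m2 j.K w x) * gaugeShiftUnit L (kingVol L j) a m2 j.K A x₀ w|
      ≤ ((L ^ j.K : ℕ) : ℝ) * (a * c₀ / ((L ^ j.K : ℕ) : ℝ) * pL * (latticeConst (d + 1) (δ₀ / 2) * (2 / δ₀))) := mul_le_mul_of_nonneg_left hmain hN0.le
    _ = a * c₀ * pL * (latticeConst (d + 1) (δ₀ / 2) * (2 / δ₀)) := by field_simp

end KingVolumes

end Summit.QuantumFields.YangMills.BalabanUVNodes.N15KingModelRung.Curved

end
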